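import Summits.CriticalPhenomena.Ising3DConformalLimit.Theses.MarkovRigidity
import Summits.CriticalPhenomena.Ising3DConformalLimit.Theses.HyperoctahedralRP
import Summits.CriticalPhenomena.Ising3DConformalLimit.Theorems.MarkovRigidityFieldRealisation
import Summits.CriticalPhenomena.Ising3DConformalLimit.Theorems.MarkovRigidityCubicSymmetryOfLimit
import Summits.CriticalPhenomena.Ising3DConformalLimit.Theorems.MarkovRigidityCubicClosure
import Summits.CriticalPhenomena.Ising3DConformalLimit.Theorems.HyperoctahedralRPHRP2Rigidity
import Summits.CriticalPhenomena.Ising3DConformalLimit.Theorems.HyperoctahedralRPLimitRotationInvariant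
import Summits.CriticalPhenomena.Ising3DConformalLimit.Theorems.MonotoneBlockingLimitsAreConformalSummit
import Literature.Probability.LatticeModels.CriticalScalingDimension
import HarnessLib

/-!
# Strategist location file — crux `NelsonPolyakovRigidity` (stmt-CriticalPhenomena-11243), REDIRECT r1

Kernel-checked map of WHERE the crux sits relative to the sub-problem `Ising3DConformalLimit` (S) and its
proved anatomy `S ↔ 1981 ∧ 1982 ∧ 0636` (`LimitsAreConformalSummit.summit_iff_three_hubs`), written by
planner-cstrat-stmt-CriticalPhenomena-11243-r1-0 (2026-08-17). No `sorry`, no new axioms; every ingredient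
is a landed theorem of the tree.

* §1 `inversionUpgradeNormalised_of_markov` : `MarkovInheritance → NelsonPolyakovRigidity →
  HyperoctahedralRP.InversionUpgradeNormalised` — the route's own pair (MI, NPR) is a SUFFICIENT CONDITION for
  hub item stmt-1982 (and for nothing more: E₀ = 1981 and NG = 0636 are imported verbatim). With
  `inversionUpgradeNormalised_of_summit : S → 1982` (tree) the hub is strictly below S; NPR itself is
  lattice-free and incomparable with S (probes in `bc/`).
* §2 `NPRInv` — the INVERSION HALF of NPR for ISOTROPIC laws (same 15 hypotheses, plus `IsEuclideanInvariant S`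
  and `IsScaleCovariant Δ S`, conclusion `IsInversionCovariant Δ S`, no `∃ A`), and
  `nprInv_of_npr : NelsonPolyakovRigidity → NPRInv` (via the landed `CubicClosure_proof`): NPRInv is AT MOST as
  strong as NPR; the gap is exactly NPR's isotropy half ("the anisotropy of a scalar germ-Markov field is a metric").
* §3 `closes_retarget : MarkovInheritance → NPRInv → ExistsScaleCovariantLimit → IsingEuclidUpgradeR4NonGaussian →
  Ising3DConformalLimit` — the route closes from the WEAKER crux, because rotation invariance of every normalised
  non-degenerate translation-invariant scale-covariant Ising₃ limit is now a theorem of the tree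
  (`HRP2Rigidity_of`, item 1979; `limitRotationInvariant_proof`, item 1980, landed 2026-08-16). Hence NPR's isotropy
  half is summit-redundant: the largest sub-crux of NPR that the summit still needs is NPRInv.
* §4 `inversionUpgradeNormalised_of_markovInv : MarkovInheritance → NPRInv → InversionUpgradeNormalised`.
-/

namespace Summit.CriticalPhenomena.Ising3DConformalLimit.Cruxes.NelsonPolyakovRigidity.Strategist

open Literature.Probability.LatticeModels
open Summit.CriticalPhenomena.Ising3DConformalLimit.Theses

/-! ## §1 The route's pair (MI, NPR) lands exactly on hub item 1982 -/

/-- **MI ∧ NPR ⟹ hub 1982.** Given a normalised, non-degenerate, Euclidean-invariant, scale-covariant pointwise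
limit `S` of `criticalCorr 3`: `fieldRealisation_proof` (item 11245, landed) realises it as the moment densities of
a law `μ` with all the OS-type clauses; `MarkovInheritance` makes `μ` germ-Markov; `scalingDimension_mem_Icc_holds`
pins `1/2 ≤ Δ ≤ 1`; `NelsonPolyakovRigidity` returns `A` with `S ∘ A` Möbius; `cubicSymmetryOfLimit_proof` +
`CubicClosure_proof` (items 6229/6230, landed) remove `A`; keep the inversion clause. [folklore] -/
theorem inversionUpgradeNormalised_of_markov
    (hMI : MarkovRigidity.MarkovInheritance) (hNPR : MarkovRigidity.NelsonPolyakovRigidity) :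
    HyperoctahedralRP.InversionUpgradeNormalised := by
  intro ρ Δ S hρ hlim hnorm hnd heuc hsc
  have htr : IsTranslationInvariant S := heuc.1
  obtain ⟨hcont, μ, hprob, hmom, hexp, hdens, htrl, hscl, hθ, hRP, hclust⟩ :=
    MarkovRigidityFieldRealisation.fieldRealisation_proof ρ Δ S hρ hlim hnorm hnd htr hsc
  have hIcc : Δ ∈ Set.Icc (1 / 2 : ℝ) 1 := scalingDimension_mem_Icc_holds ρ Δ S hlim hsc hnd hρ
  have hMarkov := hMI ρ Δ S μ hρ hlim hnorm hnd htr hsc hprob hmom hexp hdens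
  obtain ⟨A, hA⟩ :=
    hNPR μ Δ S hprob hmom hexp htrl hscl hθ hRP hclust hMarkov hIcc.1 hIcc.2 hdens hnorm hcont hnd
  have hcubic := MarkovRigidityCubicSymmetry.cubicSymmetryOfLimit_proof ρ Δ S hρ hlim hnorm hnd htr hsc
  have hΔ : 0 < Δ := by linarith [hIcc.1]
  have hMoeb : IsMoebiusCovariant Δ S := Theorems.CubicClosure_proof Δ S A hΔ hnd hcubic hA
  exact hMoeb.2.2

/-- Tree fact, re-stated for the map: the hub is NECESSARY for the sub-problem (`S → 1982`). -/
example : _root_.Ising3DConformalLimit → HyperoctahedralRP.InversionUpgradeNormalised :=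
  Theorems.LimitsAreConformalSummit.inversionUpgradeNormalised_of_summit

/-- Tree fact, re-stated for the map: the sub-problem is EXACTLY the three hub items. -/
example : _root_.Ising3DConformalLimit ↔
    (HyperoctahedralRP.ExistsScaleCovariantLimit ∧ HyperoctahedralRP.InversionUpgradeNormalised ∧
      HyperoctahedralRP.IsingEuclidUpgradeR4NonGaussian) :=
  Theorems.LimitsAreConformalSummit.summit_iff_three_hubs

/-- The two copies of the shared items are the same terms (dedup by normalised signature). -/
example : MarkovRigidity.ExistsScaleCovariantLimit ↔ HyperoctahedralRP.ExistsScaleCovariantLimit := Iff.rfl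
example : MarkovRigidity.IsingEuclidUpgradeR4NonGaussian ↔ HyperoctahedralRP.IsingEuclidUpgradeR4NonGaussian :=
  Iff.rfl

/-- The route's open cruxes are JOINTLY AT LEAST the summit through the hubs (redirect bookkeeping: attacked
conjunct = 1982 via (MI, NPR); residuals = 1981, 0636). -/
theorem summit_of_route_cruxes (hMI : MarkovRigidity.MarkovInheritance)
    (hNPR : MarkovRigidity.NelsonPolyakovRigidity) (hE : MarkovRigidity.ExistsScaleCovariantLimit)
    (hNG : MarkovRigidity.IsingEuclidUpgradeR4NonGaussian) : _root_.Ising3DConformalLimit :=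
  Theorems.LimitsAreConformalSummit.summit_iff_three_hubs.mpr
    ⟨hE, inversionUpgradeNormalised_of_markov hMI hNPR, hNG⟩

/-! ## §2 The re-target: the inversion half of NPR for isotropic laws -/

/-- **NPRInv** — `NelsonPolyakovRigidity` with its isotropy half removed: the SAME fifteen hypotheses on
`(μ, Δ, S)` (binder text verbatim), plus `IsEuclideanInvariant S` and `IsScaleCovariant Δ S` at the level of the
densities, conclusion `IsInversionCovariant Δ S` (no `∃ A`). In words: a translation-invariant, scale-covariant
(`1/2 ≤ Δ ≤ 1`), time-reflection invariant, OS-reflection-positive, time-clustering probability law on `𝒮'(ℝ³)`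
with all and exponential moments, germ-Markov for open balls and open half-spaces, whose moment densities are
normalised / continuous / non-degenerate AND Euclidean invariant, has inversion-covariant densities. This is
Polyakov's "scale + locality ⇒ conformal" for ONE real scalar field in Nelson's axioms, isotropic case. -/
def NPRInv : Prop :=
  ∀ (μ : MeasureTheory.Measure (Literature.MathematicalPhysics.QuantumLattice.FieldConfig (EuclideanSpace ℝ (Fin 3)))) (Δ : ℝ) (S : Literature.Probability.LatticeModels.CorrFamily 3), MeasureTheory.IsProbabilityMeasure μ → Literature.MathematicalPhysics.QuantumLattice.HasAllMoments μ → (∀ f : SchwartzMap (EuclideanSpace ℝ (Fin 3)) ℝ, MeasureTheory.Integrable (fun ω : Literature.MathematicalPhysics.QuantumLattice.FieldConfig (EuclideanSpace ℝ (Fin 3)) => Real.exp (ω f)) μ) → Literature.MathematicalPhysics.QuantumLattice.IsTranslationInvariantLaw μ → (∀ (s : ℝ) (hs : 0 < s), MeasureTheory.Measure.map (Literature.MathematicalPhysics.QuantumLattice.FieldConfig.act ((s ^ (Δ - 3 : ℝ)) • Literature.MathematicalPhysics.QuantumLattice.dilateTest s hs.ne')) μ = μ) → Literature.MathematicalPhysics.QuantumLattice.IsTimeReflectionInvariantLaw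 3 μ → (∀ (n : ℕ) (c : Fin n → ℂ) (f : Fin n → SchwartzMap (EuclideanSpace ℝ (Fin 3)) ℝ), (∀ i, tsupport ⇑(f i) ⊆ {x : EuclideanSpace ℝ (Fin 3) | 0 < x 0}) → 0 ≤ (∑ i, ∑ j, (starRingEnd ℂ) (c i) * c j * Literature.MathematicalPhysics.QuantumLattice.genFunctional μ (f j - Literature.MathematicalPhysics.QuantumLattice.thetaTest 3 (f i))).re ∧ (∑ i, ∑ j, (starRingEnd ℂ) (c i) * c j * Literature.MathematicalPhysics.QuantumLattice.genFunctional μ (f j - Literature.MathematicalPhysics.QuantumLattice.thetaTest 3 (f i))).im = 0) → (∀ f g : SchwartzMap (EuclideanSpace ℝ (Fin 3)) ℝ, Filter.Tendsto (fun t : ℝ => Literature.MathematicalPhysics.QuantumLattice.genFunctional μ (f + Literature.MathematicalPhysics.QuantumLattice.timeShiftTest 3 t g)) Filter.atTop (nhds (Literature.MathematicalPhysics.QuantumLattice.genFunctional μ f * Literature.MathematicalPhysics.QuantumLattice.genFunctional μ g))) → (∀ (sig : Set (EuclideanSpace ℝ (Fin 3)) → MeasurableSpace (Literature.MathematicalPhysics.QuantumLattice.FieldConfig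 (EuclideanSpace ℝ (Fin 3)))), (sig = fun A => ⨆ (f : SchwartzMap (EuclideanSpace ℝ (Fin 3)) ℝ) (_ : tsupport ⇑f ⊆ A), MeasurableSpace.comap (fun ω : Literature.MathematicalPhysics.QuantumLattice.FieldConfig (EuclideanSpace ℝ (Fin 3)) => ω f) (borel ℝ)) → ∀ (U : Set (EuclideanSpace ℝ (Fin 3))), ((∃ (c : EuclideanSpace ℝ (Fin 3)) (r : ℝ), U = Metric.ball c r) ∨ (∃ (v : EuclideanSpace ℝ (Fin 3)) (a : ℝ), v ≠ 0 ∧ U = {x | a < inner ℝ x v})) → ∀ (F : Literature.MathematicalPhysics.QuantumLattice.FieldConfig (EuclideanSpace ℝ (Fin 3)) → ℝ), @Measurable _ _ (⨅ (ε : ℝ) (_ : 0 < ε), sig (Metric.thickening ε U)) _ F → (∃ C : ℝ, ∀ ω, |F ω| ≤ C) → MeasureTheory.condExp ((⨅ (ε : ℝ) (_ : 0 < ε), sig (Metric.thickening ε Uᶜ)) ⊔ ⨅ (ε : ℝ) (_ : 0 < ε), sig (Metric.thickening ε (frontier U))) μ F =ᵐ[μ] MeasureTheory.condExp (⨅ (ε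 : ℝ) (_ : 0 < ε), sig (Metric.thickening ε (frontier U))) μ F) → 1 / 2 ≤ Δ → Δ ≤ 1 → (∀ (n : ℕ) (f : Fin n → SchwartzMap (EuclideanSpace ℝ (Fin 3)) ℝ), Literature.MathematicalPhysics.QuantumLattice.moment μ n f = ∫ x : Fin n → EuclideanSpace ℝ (Fin 3), S n x * ∏ i, f i (x i)) → (∀ n z, z ∉ Literature.Probability.LatticeModels.NonCoincident 3 n → S n z = 0) → (∀ n, ContinuousOn (S n) (Literature.Probability.LatticeModels.NonCoincident 3 n)) → Literature.Probability.LatticeModels.IsNondegenerateTwoPoint S → Literature.Probability.LatticeModels.IsEuclideanInvariant S → Literature.Probability.LatticeModels.IsScaleCovariant Δ S → Literature.Probability.LatticeModels.IsInversionCovariant Δ S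

/-- **NPR ⟹ NPRInv** (the re-target is at most as strong as the crux). Given the hypotheses of `NPRInv`, NPR
returns `A` with `S ∘ A` Möbius of weight `Δ`; `S` is invariant under all linear isometries, in particular under
the signed permutation matrices, so the landed `CubicClosure_proof` (item 6230: "an `O_h`-invariant metric is
round") gives `IsMoebiusCovariant Δ S`; keep the inversion clause. [folklore] -/
theorem nprInv_of_npr (hNPR : MarkovRigidity.NelsonPolyakovRigidity) : NPRInv := by
  intro μ Δ S hprob hmom hexp htrl hscl hθ hRP hclust hmk hΔ1 hΔ2 hdens hnorm hcont hnd heuc hsc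
  obtain ⟨A, hA⟩ :=
    hNPR μ Δ S hprob hmom hexp htrl hscl hθ hRP hclust hmk hΔ1 hΔ2 hdens hnorm hcont hnd
  have hΔ : 0 < Δ := by linarith
  have hcubic : ∀ (L : EuclideanSpace ℝ (Fin 3) ≃ₗᵢ[ℝ] EuclideanSpace ℝ (Fin 3)),
      (∀ i : Fin 3, ∃ j : Fin 3, L (EuclideanSpace.single i 1) = EuclideanSpace.single j 1 ∨
        L (EuclideanSpace.single i 1) = -EuclideanSpace.single j 1) →
      ∀ (n : ℕ) (x : Fin n → EuclideanSpace ℝ (Fin 3)), S n (fun k => L (x k)) = S n x :=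
    fun L _ n x => heuc.2 n L x
  have hMoeb : IsMoebiusCovariant Δ S := Theorems.CubicClosure_proof Δ S A hΔ hnd hcubic hA
  exact hMoeb.2.2

/-! ## §3 The route closes from the weaker crux (isotropy is a theorem of the tree) -/

/-- **`closes_retarget`**: `MarkovInheritance → NPRInv → ExistsScaleCovariantLimit → IsingEuclidUpgradeR4NonGaussian
→ Ising3DConformalLimit`. Take `(ρ, Δ, S)` from existence; `HRP2Rigidity_of` (item 1979) and
`limitRotationInvariant_proof` (item 1980) give `IsRotationInvariant S`; `fieldRealisation_proof` gives the law `μ`;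
`MarkovInheritance` makes it germ-Markov; the window is `scalingDimension_mem_Icc_holds`; `NPRInv` gives inversion
covariance; `IsingEuclidUpgradeR4NonGaussian` gives `U₄ ≢ 0`. [folklore] -/
theorem closes_retarget (hMI : MarkovRigidity.MarkovInheritance) (hInv : NPRInv)
    (hE : MarkovRigidity.ExistsScaleCovariantLimit) (hNG : MarkovRigidity.IsingEuclidUpgradeR4NonGaussian) :
    _root_.Ising3DConformalLimit := by
  obtain ⟨ρ, Δ, S, hρ, hΔ, hlim, hnorm, hnd, htr, hsc⟩ := hE
  have hrot : IsRotationInvariant S :=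
    Cruxes.LimitRotationInvariant.QuarterTurnLiouville.limitRotationInvariant_proof
      Cruxes.HRP2Rigidity.XRayMellin.HRP2Rigidity_of ρ Δ S hρ hlim hnorm hnd htr hsc
  obtain ⟨hcont, μ, hprob, hmom, hexp, hdens, htrl, hscl, hθ, hRP, hclust⟩ :=
    MarkovRigidityFieldRealisation.fieldRealisation_proof ρ Δ S hρ hlim hnorm hnd htr hsc
  have hIcc : Δ ∈ Set.Icc (1 / 2 : ℝ) 1 := scalingDimension_mem_Icc_holds ρ Δ S hlim hsc hnd hρ
  have hMarkov := hMI ρ Δ S μ hρ hlim hnorm hnd htr hsc hprob hmom hexp hdens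
  have hinv : IsInversionCovariant Δ S :=
    hInv μ Δ S hprob hmom hexp htrl hscl hθ hRP hclust hMarkov hIcc.1 hIcc.2 hdens hnorm hcont hnd
      ⟨htr, hrot⟩ hsc
  exact ⟨ρ, Δ, S, hρ, hΔ, hlim, hnd, ⟨⟨htr, hrot⟩, hsc, hinv⟩, hNG ρ S hρ hlim hnd⟩

/-! ## §4 … and the weaker crux still lands on hub 1982 -/

/-- **MI ∧ NPRInv ⟹ hub 1982** (Euclidean invariance is a hypothesis of the hub, so no rotation theorem is even
needed here). [folklore] -/
theorem inversionUpgradeNormalised_of_markovInv (hMI : MarkovRigidity.MarkovInheritance) (hInv : NPRInv) :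
    HyperoctahedralRP.InversionUpgradeNormalised := by
  intro ρ Δ S hρ hlim hnorm hnd heuc hsc
  have htr : IsTranslationInvariant S := heuc.1
  obtain ⟨hcont, μ, hprob, hmom, hexp, hdens, htrl, hscl, hθ, hRP, hclust⟩ :=
    MarkovRigidityFieldRealisation.fieldRealisation_proof ρ Δ S hρ hlim hnorm hnd htr hsc
  have hIcc : Δ ∈ Set.Icc (1 / 2 : ℝ) 1 := scalingDimension_mem_Icc_holds ρ Δ S hlim hsc hnd hρ
  have hMarkov := hMI ρ Δ S μ hρ hlim hnorm hnd htr hsc hprob hmom hexp hdens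
  exact hInv μ Δ S hprob hmom hexp htrl hscl hθ hRP hclust hMarkov hIcc.1 hIcc.2 hdens hnorm hcont hnd heuc hsc

end Summit.CriticalPhenomena.Ising3DConformalLimit.Cruxes.NelsonPolyakovRigidity.Strategist
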